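import Literature.AlgebraicGeometry.Motives.HodgeLieWeightOneRankFourBlocks
import HarnessLib

/-!
# Weight-one Hodge structures with Hodge group of rank four, not of CM type. B: the `ad P`-graded basis
# `𝔥_ℂ = ℂ(2P − 1) ⊕ ℂE ⊕ ℂF ⊕ ℂD` with `D P = P D`

Family `hodge`, layer `Literature/AlgebraicGeometry/Motives`; THEOREMS ONLY (no definition, no named fact; D-0026).
Second file of the lane MT-RANK-FIVE of the cell `pub-hodgecm2` (setting as in `Motives/HodgeLieWeightOneRankFourBlocks`),
now with **`dim_ℚ 𝔥 = 4`**.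

* `exists_diag_basis_of_finrank_eq_four` — **there is `D ∈ 𝔥_ℂ` commuting with `P` such that `2P − 1`, `E`, `F`, `D`
  are linearly independent and span `𝔥_ℂ`.**  Proof: a rational `X' ∈ 𝔥` with `X'_ℂ ∉ ⟨2P−1, E, F⟩` exists by dimension
  (`dim_ℂ 𝔥_ℂ = dim_ℚ 𝔥 = 4`); its blocks `E' = P X'_ℂ (1−P)`, `F' = (1−P) X'_ℂ P` lie in `𝔥_ℂ` and
  `F' v = conj (E' (conj v))`; if `E' = cE` then `F' = c̄F` and `D = X'_ℂ − E' − F'` commutes with `P` and completes the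
  basis; otherwise `2P−1, E, F, E', F'` would be five independent elements of the four-dimensional `𝔥_ℂ` (the `(±)`-blocks
  separate them).  In Lie-theoretic terms: the root spaces of `ad(2P − 1)` on `𝔥_ℂ` for the roots `±2` are the lines
  `ℂE`, `ℂF`, and the zero-root space is `ℂ(2P−1) ⊕ ℂD`.

## References

* [MoonenZarhin1999LowDim] B. Moonen, Yu. Zarhin, *Hodge classes on abelian varieties of low dimension*, Math. Ann. 315
  (1999), §2.
* [Deligne1982HodgeCycles] P. Deligne, *Hodge cycles on abelian varieties*, LNM 900 (1982), I §3 (proof of Prop. 3.4).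
* [FultonHarris1991] W. Fulton, J. Harris, *Representation Theory*, GTM 129 (1991), Lecture 11 (§11.1), §14.1 (root
  space decomposition).
-/

noncomputable section

open scoped TensorProduct

namespace Literature.AlgebraicGeometry.Motives

universe u

namespace HodgeStructure

open ProjectorBlocks

variable {V : Type u} [AddCommGroup V] [Module ℚ V] [Module.Finite ℚ V] [HodgeTensorFacts.{u, u}] {n : ℤ}
  {S : Type u} [Fintype S] [DecidableEq S] {deg : S → ℤ}

/-! ## §2 The `ad P`-graded basis of `𝔥_ℂ` in rank four -/

/-- **`𝔥_ℂ = ℂ(2P − 1) ⊕ ℂE ⊕ ℂF ⊕ ℂD` with `D P = P D`.**  For `X ∈ 𝔥 ∖ End_Hdg(V)` and `dim_ℚ 𝔥 = 4` (weight `1`,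
degrees in `{0,1}`) there is `D ∈ 𝔥_ℂ` commuting with `P` such that `2P − 1`, `E = P X_ℂ (1 − P)`, `F = (1 − P) X_ℂ P`, `D`
are linearly independent and span `𝔥_ℂ`.  Proof: a rational `X' ∈ 𝔥` with `X'_ℂ ∉ ⟨2P−1, E, F⟩` exists by dimension; its
blocks `E' = P X'_ℂ (1−P)`, `F' = (1−P) X'_ℂ P` lie in `𝔥_ℂ` and `F' v = conj (E' (conj v))`; if `E' = cE` then
`F' = c̄F` and `D = X'_ℂ − E' − F'` works; otherwise `2P−1, E, F, E', F'` are five independent elements of the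
four-dimensional `𝔥_ℂ`.  (The root spaces of `ad(2P−1)` on `𝔥_ℂ` for the roots `±2` are the lines `ℂE`, `ℂF`.)
[cite: MoonenZarhin1999LowDim, §2] [cite: Deligne1982HodgeCycles, I §3 (proof of Prop. 3.4)] [cite: FultonHarris1991, Lecture 11 (§11.1)] -/
theorem exists_diag_basis_of_finrank_eq_four (H : HodgeStructure V n) (hn : n = 1) (e : Module.Basis S ℂ (ℂ ⊗[ℚ] V))
    (hF : ∀ a, H.F a = Submodule.span ℂ (e '' {σ | a ≤ deg σ}))
    (hFc : ∀ a, complexConj (H.F a) = Submodule.span ℂ (e '' {σ | deg σ ≤ n - a}))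
    (hdeg : ∀ σ, deg σ = 0 ∨ deg σ = 1) {X : Module.End ℚ V} (hX : X ∈ H.hodgeLie) (hXE : X ∉ H.endAlg)
    (h4 : Module.finrank ℚ H.hodgeLie = 4) :
    ∃ D ∈ H.hodgeLieC, D * gradingEnd e deg = gradingEnd e deg * D ∧
      LinearIndependent ℂ ![(2 : ℂ) • gradingEnd e deg - 1,
        gradingEnd e deg * X.baseChange ℂ * (1 - gradingEnd e deg),
        (1 - gradingEnd e deg) * X.baseChange ℂ * gradingEnd e deg, D] ∧
      ∀ Z ∈ H.hodgeLieC, ∃ c : Fin 4 → ℂ, Z = c 0 • ((2 : ℂ) • gradingEnd e deg - 1) +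
        c 1 • (gradingEnd e deg * X.baseChange ℂ * (1 - gradingEnd e deg)) +
        c 2 • ((1 - gradingEnd e deg) * X.baseChange ℂ * gradingEnd e deg) + c 3 • D := by
  classical
  subst hn
  set P := gradingEnd e deg with hP
  set Y := X.baseChange ℂ with hY
  set E := P * Y * (1 - P) with hEdef
  set F := (1 - P) * Y * P with hFdef
  have hPP : P * P = P := gradingEnd_mul_gradingEnd_of_deg e hdeg
  have hPE : P * E = E := by rw [hEdef, ← mul_assoc, ← mul_assoc, hPP]
  have hEP : E * P = 0 := by rw [hEdef, mul_assoc (P * Y) (1 - P) P, sub_mul, one_mul, hPP, sub_self, mul_zero]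
  have hPF : P * F = 0 := by
    rw [hFdef, mul_assoc (1 - P) Y P, ← mul_assoc P (1 - P) (Y * P), mul_sub, mul_one, hPP, sub_self, zero_mul]
  have hFP : F * P = F := by rw [hFdef, mul_assoc ((1 - P) * Y) P P, hPP]
  obtain ⟨hE0, hF0⟩ := projE_ne_zero_of_not_mem_endAlg H rfl e hF hFc hdeg hXE
  rw [← hP, ← hY, ← hEdef] at hE0
  rw [← hP, ← hY, ← hFdef] at hF0
  have hΘ0 : (2 : ℂ) • P - 1 ≠ 0 := by
    intro h
    apply hE0
    rw [← hPE, ← (mul_theta hPP).1, h, mul_zero, zero_mul]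
  -- membership of the three standard elements
  have hΘ' : (2 : ℂ) • P - 1 ∈ H.hodgeLieC := by
    have h := two_smul_gradingEnd_sub_mem_hodgeLieC H e hF hFc
    rw [Int.cast_one, one_smul] at h
    exact h
  have hYM : Y ∈ H.hodgeLieC := H.baseChange_mem_hodgeLieC hX
  obtain ⟨hEM, hFM⟩ := projE_mem_hodgeLieC H e hF hFc hdeg hYM
  rw [← hP, ← hEdef] at hEM
  rw [← hP, ← hFdef] at hFM
  have hdim : Module.finrank ℂ H.hodgeLieC = 4 := by rw [finrank_hodgeLieC, h4]
  -- the span of the three standard elements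
  set S₃ : Submodule ℂ (Module.End ℂ (ℂ ⊗[ℚ] V)) :=
    Submodule.span ℂ (({(2 : ℂ) • P - 1, E, F} : Finset (Module.End ℂ (ℂ ⊗[ℚ] V))) : Set _) with hS₃
  have hS₃le : Module.finrank ℂ S₃ ≤ 3 :=
    (finrank_span_finset_le_card _).trans (Finset.card_le_three)
  have hΘS : (2 : ℂ) • P - 1 ∈ S₃ := Submodule.subset_span (by simp)
  have hES : E ∈ S₃ := Submodule.subset_span (by simp)
  have hFS : F ∈ S₃ := Submodule.subset_span (by simp)
  -- a rational `X'` with `X'_ℂ ∉ S₃`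
  obtain ⟨X', hX', hX'S⟩ : ∃ X' ∈ H.hodgeLie, X'.baseChange ℂ ∉ S₃ := by
    by_contra hcon
    push Not at hcon
    have hle : H.hodgeLieC ≤ S₃ := by
      rw [hodgeLieC]
      exact Submodule.span_le.2 (by rintro _ ⟨X', hX', rfl⟩; exact hcon X' hX')
    have h := Submodule.finrank_mono hle
    omega
  set Y' := X'.baseChange ℂ with hY'
  set E' := P * Y' * (1 - P) with hE'def
  set F' := (1 - P) * Y' * P with hF'def
  have hY'M : Y' ∈ H.hodgeLieC := H.baseChange_mem_hodgeLieC hX'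
  obtain ⟨hE'M, hF'M⟩ := projE_mem_hodgeLieC H e hF hFc hdeg hY'M
  rw [← hP, ← hE'def] at hE'M
  rw [← hP, ← hF'def] at hF'M
  have hPE' : P * E' = E' := by rw [hE'def, ← mul_assoc, ← mul_assoc, hPP]
  have hE'P : E' * P = 0 := by rw [hE'def, mul_assoc (P * Y') (1 - P) P, sub_mul, one_mul, hPP, sub_self, mul_zero]
  have hPF' : P * F' = 0 := by
    rw [hF'def, mul_assoc (1 - P) Y' P, ← mul_assoc P (1 - P) (Y' * P), mul_sub, mul_one, hPP, sub_self, zero_mul]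
  have hF'P : F' * P = F' := by rw [hF'def, mul_assoc ((1 - P) * Y') P P, hPP]
  -- `F' v = conj (E' (conj v))` and the same for `E, F`
  have hconj' : ∀ v, F' v = conj (E' (conj v)) := fun v => (conj_projE_conj_apply H rfl e hF hFc X' v).symm
  have hconj : ∀ v, F v = conj (E (conj v)) := fun v => (conj_projE_conj_apply H rfl e hF hFc X v).symm
  -- if `E' = c E` then `F' = c̄ F`
  have hscal : ∀ c : ℂ, E' = c • E → F' = (starRingEnd ℂ c) • F := by
    intro c hc
    refine LinearMap.ext fun v => ?_
    rw [hconj' v, hc, LinearMap.smul_apply, conj_smul, ← hconj v, LinearMap.smul_apply]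
  have hscal' : ∀ c : ℂ, F' = c • F → E' = (starRingEnd ℂ c) • E := by
    intro c hc
    refine LinearMap.ext fun v => ?_
    have h1 : E' v = conj (F' (conj v)) := by rw [hconj' (conj v), conj_conj, conj_conj]
    have h2 : E v = conj (F (conj v)) := by rw [hconj (conj v), conj_conj, conj_conj]
    rw [h1, hc, LinearMap.smul_apply, conj_smul, ← h2, LinearMap.smul_apply]
  by_cases hcase : ∃ c : ℂ, E' = c • E
  · -- Case 1: `D = X'_ℂ − E' − F'`
    obtain ⟨c, hc⟩ := hcase
    have hFc' := hscal c hc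
    set D := Y' - E' - F' with hDdef
    have hDM : D ∈ H.hodgeLieC := H.hodgeLieC.sub_mem (H.hodgeLieC.sub_mem hY'M hE'M) hF'M
    have hDP : D * P = P * D := by
      have h1 : D * P = P * Y' * P := by
        rw [hDdef, sub_mul, sub_mul, hE'P, sub_zero, hF'P, hF'def, sub_mul (1 : Module.End ℂ (ℂ ⊗[ℚ] V)) P Y',
          one_mul, sub_mul Y' (P * Y') P, sub_sub_cancel]
      have h2 : P * D = P * Y' * P := by
        rw [hDdef, mul_sub, mul_sub, hPE', hPF', sub_zero, hE'def, mul_sub (P * Y') 1 P, mul_one, sub_sub_cancel]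
      rw [h1, h2]
    have hDS : D ∉ S₃ := by
      intro hDS
      apply hX'S
      have h : Y' = D + c • E + (starRingEnd ℂ c) • F := by rw [hDdef, ← hc, ← hFc']; abel
      rw [h]
      exact S₃.add_mem (S₃.add_mem hDS (S₃.smul_mem _ hES)) (S₃.smul_mem _ hFS)
    let v : Fin 4 → Module.End ℂ (ℂ ⊗[ℚ] V) := ![(2 : ℂ) • P - 1, E, F, D]
    have hv : ∀ i, v i ∈ H.hodgeLieC := by
      intro i
      fin_cases i
      · exact hΘ'
      · exact hEM
      · exact hFM
      · exact hDM
    have hli : LinearIndependent ℂ v := by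
      rw [Fintype.linearIndependent_iff]
      intro g hg
      have hg' : g 0 • ((2 : ℂ) • P - 1) + g 1 • E + g 2 • F + g 3 • D = 0 := by
        simpa [Fin.sum_univ_four, v] using hg
      have hg1 : g 1 = 0 := by
        have h := congrArg (fun T : Module.End ℂ (ℂ ⊗[ℚ] V) => P * T * (1 - P)) hg'
        simp only [mul_add, add_mul, mul_smul_comm, smul_mul_assoc, (blocks_theta hPP).1, (blocks_E hPE hEP).1,
          (blocks_F hPF hFP).1, (blocks_D hPP hDP).1, smul_zero, zero_add, add_zero, mul_zero, zero_mul] at h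
        exact (smul_eq_zero.1 h).resolve_right hE0
      have hg2 : g 2 = 0 := by
        have h := congrArg (fun T : Module.End ℂ (ℂ ⊗[ℚ] V) => (1 - P) * T * P) hg'
        simp only [mul_add, add_mul, mul_smul_comm, smul_mul_assoc, (blocks_theta hPP).2, (blocks_E hPE hEP).2,
          (blocks_F hPF hFP).2, (blocks_D hPP hDP).2, smul_zero, zero_add, add_zero, mul_zero, zero_mul] at h
        exact (smul_eq_zero.1 h).resolve_right hF0
      rw [hg1, hg2, zero_smul, zero_smul, add_zero, add_zero] at hg'
      have hg3 : g 3 = 0 := by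
        by_contra h3
        apply hDS
        have h' : g 3 • D = -(g 0 • ((2 : ℂ) • P - 1)) := eq_neg_of_add_eq_zero_right hg'
        have h : D = -(((g 3)⁻¹ * g 0) • ((2 : ℂ) • P - 1)) := by
          calc D = (g 3)⁻¹ • (g 3 • D) := by rw [smul_smul, inv_mul_cancel₀ h3, one_smul]
            _ = -(((g 3)⁻¹ * g 0) • ((2 : ℂ) • P - 1)) := by rw [h', smul_neg, smul_smul]
        rw [h]
        exact S₃.neg_mem (S₃.smul_mem _ hΘS)
      rw [hg3, zero_smul, add_zero] at hg'
      have hg0 : g 0 = 0 := (smul_eq_zero.1 hg').resolve_right hΘ0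
      intro i
      fin_cases i
      · exact hg0
      · exact hg1
      · exact hg2
      · exact hg3
    have hle : Submodule.span ℂ (Set.range v) ≤ H.hodgeLieC := by
      rw [Submodule.span_le]
      rintro _ ⟨i, rfl⟩
      exact hv i
    have hdim' : Module.finrank ℂ H.hodgeLieC ≤ Module.finrank ℂ (Submodule.span ℂ (Set.range v)) := by
      rw [finrank_span_eq_card hli, Fintype.card_fin, hdim]
    have heq : Submodule.span ℂ (Set.range v) = H.hodgeLieC := Submodule.eq_of_le_of_finrank_le hle hdim'
    refine ⟨D, hDM, hDP, hli, fun Z hZ => ?_⟩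
    rw [← heq, Submodule.mem_span_range_iff_exists_fun] at hZ
    obtain ⟨c', hc'⟩ := hZ
    refine ⟨c', ?_⟩
    rw [← hc', Fin.sum_univ_four]
    rfl
  · -- Case 2: five independent elements, contradiction
    exfalso
    push Not at hcase
    have hcase' : ∀ c : ℂ, F' ≠ c • F := fun c h => hcase (starRingEnd ℂ c) (hscal' c h)
    have hE'0 : E' ≠ 0 := fun h => hcase 0 (by rw [h, zero_smul])
    let w : Fin 5 → Module.End ℂ (ℂ ⊗[ℚ] V) := ![(2 : ℂ) • P - 1, E, F, E', F']
    have hw : ∀ i, w i ∈ H.hodgeLieC := by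
      intro i
      fin_cases i
      · exact hΘ'
      · exact hEM
      · exact hFM
      · exact hE'M
      · exact hF'M
    have hli : LinearIndependent ℂ w := by
      rw [Fintype.linearIndependent_iff]
      intro g hg
      have hg' : g 0 • ((2 : ℂ) • P - 1) + g 1 • E + g 2 • F + g 3 • E' + g 4 • F' = 0 := by
        simpa [Fin.sum_univ_five, w] using hg
      -- `(+)`-block: `g 1 • E + g 3 • E' = 0`
      have hplus : g 1 • E + g 3 • E' = 0 := by
        have h := congrArg (fun T : Module.End ℂ (ℂ ⊗[ℚ] V) => P * T * (1 - P)) hg'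
        simp only [mul_add, add_mul, mul_smul_comm, smul_mul_assoc, (blocks_theta hPP).1, (blocks_E hPE hEP).1,
          (blocks_F hPF hFP).1, (blocks_E hPE' hE'P).1, (blocks_F hPF' hF'P).1,
          smul_zero, zero_add, add_zero, mul_zero, zero_mul] at h
        exact h
      have hminus : g 2 • F + g 4 • F' = 0 := by
        have h := congrArg (fun T : Module.End ℂ (ℂ ⊗[ℚ] V) => (1 - P) * T * P) hg'
        simp only [mul_add, add_mul, mul_smul_comm, smul_mul_assoc, (blocks_theta hPP).2, (blocks_E hPE hEP).2,
          (blocks_F hPF hFP).2, (blocks_E hPE' hE'P).2, (blocks_F hPF' hF'P).2,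
          smul_zero, zero_add, add_zero, mul_zero, zero_mul] at h
        exact h
      have hg3 : g 3 = 0 := by
        by_contra h3
        apply hcase (-((g 3)⁻¹ * g 1))
        have h' : g 3 • E' = -(g 1 • E) := eq_neg_of_add_eq_zero_right hplus
        calc E' = (g 3)⁻¹ • (g 3 • E') := by rw [smul_smul, inv_mul_cancel₀ h3, one_smul]
          _ = -(((g 3)⁻¹ * g 1) • E) := by rw [h', smul_neg, smul_smul]
          _ = (-((g 3)⁻¹ * g 1)) • E := (neg_smul _ _).symm
      have hg4 : g 4 = 0 := by
        by_contra h4'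
        apply hcase' (-((g 4)⁻¹ * g 2))
        have h' : g 4 • F' = -(g 2 • F) := eq_neg_of_add_eq_zero_right hminus
        calc F' = (g 4)⁻¹ • (g 4 • F') := by rw [smul_smul, inv_mul_cancel₀ h4', one_smul]
          _ = -(((g 4)⁻¹ * g 2) • F) := by rw [h', smul_neg, smul_smul]
          _ = (-((g 4)⁻¹ * g 2)) • F := (neg_smul _ _).symm
      rw [hg3, zero_smul, add_zero] at hplus
      rw [hg4, zero_smul, add_zero] at hminus
      have hg1 : g 1 = 0 := (smul_eq_zero.1 hplus).resolve_right hE0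
      have hg2 : g 2 = 0 := (smul_eq_zero.1 hminus).resolve_right hF0
      rw [hg1, hg2, hg3, hg4, zero_smul, zero_smul, zero_smul, zero_smul, add_zero, add_zero, add_zero,
        add_zero] at hg'
      have hg0 : g 0 = 0 := (smul_eq_zero.1 hg').resolve_right hΘ0
      intro i
      fin_cases i
      · exact hg0
      · exact hg1
      · exact hg2
      · exact hg3
      · exact hg4
    -- restrict to `𝔥_ℂ` and count
    let w' : Fin 5 → H.hodgeLieC := fun i => ⟨w i, hw i⟩
    have hli' : LinearIndependent ℂ w' := LinearIndependent.of_comp H.hodgeLieC.subtype hli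
    have h5 := hli'.fintype_card_le_finrank
    rw [Fintype.card_fin, hdim] at h5
    omega

end HodgeStructure

end Literature.AlgebraicGeometry.Motives

end
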